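import Summits.BirchSwinnertonDyer.Rank1Residual.Additive.CyclotomicThreeRankOneOneDescentAlgebra
import HarnessLib

/-!
# The canonical twisting transport WITH the Gal(K/ℚ)-eigenspace decomposition
# `2·V(K) ⊆ ι(V(ℚ)) + Φ(W(ℚ))` (cell `b2b-bsdres`, team n1011, seat p16 GEN 12; row T-IDX2 FILE 1 —
# the input of the index lemmas `QuadraticTwistTransportIndex` that remove Milne's A73 from the
# ranks-`(1,0)`/`(1,1)` `K`-side LOWER lines `XGordRankOne{Zero,One}CyclotomicThreeLowerK`)

HONEST FRAMING (cell `b2b-bsdres`, run/shared/lean/b2b/bsd-rank1-residual/, verbatim in every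
file): the goal of the cell is to DELETE the COMBINATION-SHAPED residual classes of the
Birch–Swinnerton-Dyer formula for ALL analytic-rank `≤ 1` elliptic curves over `ℚ` — "full BSD
formula for every rank `≤ 1` curve in class `C`" assembled STRICTLY from published theorems — so
that the rank-`≤ 1` remainder becomes exactly the CONSTRUCTION-SHAPED classes, which are TYPED
(missing-input `Prop`s), NOT attempted. This is not "finishing BSD". Team n1011 (N10 / N11 / O7),
seat p16: research route; the labels of X3 / X4 and the N10 / N11 / O7 marks are UNCHANGED by this
file; nothing is booked here; no Literature fact is minted; no definition.

TOOL theorems only (no `def`, no `sorry`, no named fact).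

* §1 `exists_twistMap_eq_of_conjMap_eq_neg` — over any field `F` with `2 ≠ 0` and `K = F(θ)`,
  `θ² = c`, `θ ∉ F`: the anti-fixed points of the conjugation `σ` on the completed-square model
  `V^{(1)}(K)` are the image of the twisting map `τ : V^{(c)}(F) → V^{(1)}(K)`, `(X,Y) ↦ (X/θ², Y/θ³)`
  (Silverman *AEC* X.2 Prop. 2.4 / Exercise 10.16 — the step inside the tree's
  `lift_rank_point_baseChange_quadraticTwist_one`, exported as a statement; its fixed-point twin is the
  tree's `QuadraticDescent.exists_incl_eq_of_conjMap_eq`);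
* §2 **`exists_conj_twistTransport_decomp`** — `K` a quadratic number field `∋ θ ∉ ℚ`, `θ² = c`,
  `W = C • V^{(c)}`: the conjugation `σ` and the canonical twisting transport `Φ : W(ℚ) →+ V(K)` of the
  tree's `exists_conj_twistTransport` (`Φ = e⁻¹ ∘ g⁻¹ ∘ τ ∘ e₀⁻¹`: height-doubling, `σ`-anti-invariant)
  TOGETHER WITH the eigenspace decomposition: `σ`-fixed points of `V(K)` lie in `ι(V(ℚ))`,
  `σ`-anti-fixed points lie in `Φ(W(ℚ))`, and **`∀ X ∈ V(K), ∃ v ∈ V(ℚ), w ∈ W(ℚ), 2•X = ιv + Φw`**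
  (`2X = (X + σX) + (X − σX)`; `e`, `g` are `σ`-equivariant by `pointEquivBaseChange_symm_map`,
  `congrEquiv_baseChange_map`). This is the integral form of `rank V(K) = rank V(ℚ) + rank W(ℚ)`.

References: [cite: SilvermanAEC2009, X.2 Prop. 2.4, X.5 Cor. 5.4, Exercise 10.16, Prop. VIII.5.4(b),
Thm. VIII.9.3].
-/

noncomputable section

open scoped Classical

open WeierstrassCurve WeierstrassCurve.Affine.Point Literature.NumberTheory.EllipticCurves NumberField
  Literature.NumberTheory.QuadraticFields

namespace Summit.BirchSwinnertonDyer.Rank1Residual.Additive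

/-! ## §1 The anti-fixed points of the conjugation on the completed square `V^{(1)}(K)` -/

section Eigenspaces

variable {F : Type*} {K : Type*} [Field F] [Field K] [Algebra F K] [NeZero (2 : F)]
  (h2 : Module.finrank F K = 2) {θ : K} {c : F}
  (hθ : θ ∉ Set.range (algebraMap F K)) (hc : θ ^ 2 = algebraMap F K c)

/-- **Anti-fixed points of the conjugation on the completed square come from the twist**: for
`K = F(θ)`, `θ² = c`, `θ ∉ F`, `2 ≠ 0`, `σ` the conjugation and `W/F`, a point `Z` of the
completed-square model `W^{(1)}` over `K` with `σZ = −Z` is `τ(R)` for an `R ∈ W^{(c)}(F)`, `τ` the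
twisting map `(X,Y) ↦ (X/θ², Y/θ³)` (`QuadraticDescent.twistMap`): `−(x,y) = (x,−y)` on this model, so
`x ∈ F` and `y ∈ Fθ`. Silverman, *AEC* X.2, proof of Prop. 2.4 / Exercise 10.16.
[cite: SilvermanAEC2009, Exercise 10.16] -/
theorem exists_twistMap_eq_of_conjMap_eq_neg (W : WeierstrassCurve F)
    (Z : ((W.quadraticTwist 1).baseChange K).toAffine.Point)
    (hZ : QuadraticDescent.conjMap (W.quadraticTwist 1) (Quadratic.conj h2 hθ hc) Z = -Z) :
    ∃ R : (W.quadraticTwist c).toAffine.Point, QuadraticDescent.twistMap W hθ hc R = Z := by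
  rcases Z with _ | ⟨x, y, h⟩
  · exact ⟨0, (_root_.map_zero (QuadraticDescent.twistMap W hθ hc)).trans Affine.Point.zero_def⟩
  · rw [Affine.Point.map_some, Affine.Point.neg_some, Affine.Point.some.injEq,
      QuadraticDescent.negY_quadraticTwist_one_baseChange] at hZ
    obtain ⟨a, ha⟩ := Quadratic.exists_eq_algebraMap_of_conj_eq h2 hθ hc hZ.1
    obtain ⟨b, hb⟩ := Quadratic.exists_eq_mul_of_conj_eq_neg h2 hθ hc hZ.2
    exact QuadraticDescent.exists_twistMap_eq W hθ hc h ha.symm hb.symm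

end Eigenspaces

/-! ## §2 The canonical twisting transport together with the eigenspace decomposition -/

section Transport

variable (K : Type) [Field K] [NumberField K] (V : WeierstrassCurve ℚ) [V.IsElliptic]
  (W : WeierstrassCurve ℚ) [W.IsElliptic]

omit [W.IsElliptic] in
/-- **The conjugation, the canonical twisting transport, and the eigenspace decomposition.** For a
number field `K ∋ θ` with `θ ∉ ℚ`, `θ² = c`, `[K:ℚ] = 2`, and `W = C • V^{(c)}`: there are the
conjugation `σ : K →ₐ[ℚ] K` (`σθ = −θ`, `σσ = 1`; tree `Quadratic.conj`) and an additive
`Φ : W(ℚ) →+ V(K)` with `⟨ΦP, ΦP⟩_K = 2·⟨P,P⟩_ℚ` and `σ_*(ΦP) = −ΦP` (the tree's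
`exists_conj_twistTransport`: `Φ = e⁻¹ ∘ g⁻¹ ∘ τ ∘ e₀⁻¹`, `τ` the twisting map, `e` the completion of
the square over `ℚ`, `g` a transport along an equality of equations, `e₀` the change of variables `C`)
such that, MOREOVER, every `σ`-fixed `X ∈ V(K)` is `ι(v)` for a `v ∈ V(ℚ)`, every `σ`-anti-fixed
`X ∈ V(K)` is `Φ(w)` for a `w ∈ W(ℚ)`, and **`2•X = ι(v) + Φ(w)`** for every `X ∈ V(K)`
(`2X = (X + σX) + (X − σX)`; `e`, `g` are `σ`-equivariant — `pointEquivBaseChange_symm_map`,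
`congrEquiv_baseChange_map` — so `X` is anti-fixed iff `g(eX)` is, and the anti-fixed points of the
completed square are `τ(V^{(c)}(ℚ))`, §1). Silverman, *AEC* Exercise 10.16.
[cite: SilvermanAEC2009, Exercise 10.16, X.5 Cor. 5.4, Prop. VIII.5.4(b), Thm. VIII.9.3] -/
theorem exists_conj_twistTransport_decomp (h2 : Module.finrank ℚ K = 2) {θ : K} {c : ℚ}
    (hθ : θ ∉ Set.range (algebraMap ℚ K)) (hc : θ ^ 2 = algebraMap ℚ K c)
    (C : VariableChange ℚ) (hC : C • V.quadraticTwist c = W) :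
    ∃ (σ : K →ₐ[ℚ] K) (Φ : W.toAffine.Point →+ (V.baseChange K).toAffine.Point),
      σ θ = -θ ∧ (∀ z, σ (σ z) = z) ∧
      (∀ P : W.toAffine.Point, heightPairing (Φ P) (Φ P) = 2 * heightPairing P P) ∧
      (∀ P : W.toAffine.Point, QuadraticDescent.conjMap V σ (Φ P) = -Φ P) ∧
      (∀ X : (V.baseChange K).toAffine.Point, QuadraticDescent.conjMap V σ X = X →
        ∃ v : V.toAffine.Point, V.pointToBaseChange K v = X) ∧
      (∀ X : (V.baseChange K).toAffine.Point, QuadraticDescent.conjMap V σ X = -X →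
        ∃ w : W.toAffine.Point, Φ w = X) ∧
      (∀ X : (V.baseChange K).toAffine.Point, ∃ (v : V.toAffine.Point) (w : W.toAffine.Point),
        (2 : ℤ) • X = V.pointToBaseChange K v + Φ w) := by
  haveI : NeZero (2 : ℚ) := ⟨two_ne_zero⟩
  have hc0 : c ≠ 0 := by
    rintro rfl
    have hθ0 : θ = 0 := by
      have h : θ ^ 2 = 0 := by rw [hc, _root_.map_zero]
      exact pow_eq_zero_iff (n := 2) two_ne_zero |>.mp h
    exact hθ ⟨0, by rw [_root_.map_zero, hθ0]⟩
  haveI : (V.quadraticTwist c).IsElliptic := V.isElliptic_quadraticTwist hc0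
  haveI : (V.baseChange K).IsElliptic := by rw [WeierstrassCurve.baseChange]; infer_instance
  set σ := Quadratic.conj h2 hθ hc with hσdef
  have hσθ : σ θ = -θ := Quadratic.conj_gen h2 hθ hc
  have hσσ : ∀ z, σ (σ z) = z := Quadratic.conj_conj h2 hθ hc
  obtain ⟨C₁, hC₁⟩ := V.exists_variableChange_quadraticTwist_one
  haveI : (V.quadraticTwist 1).IsElliptic := V.isElliptic_quadraticTwist one_ne_zero
  haveI : (C₁ • V).IsElliptic := by rw [hC₁]; infer_instance
  have hC₁K : (C₁ • V).baseChange K = (V.quadraticTwist 1).baseChange K :=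
    congrArg (fun X : WeierstrassCurve ℚ ↦ X.baseChange K) hC₁
  -- the maps: `e₀` (over `ℚ`), `e` (completion of the square, over `K`), `g` (transport), `τ`
  obtain ⟨e₀, he₀⟩ := exists_addEquiv_heightPairing_eq_of_smul_eq C hC
  set e : (V.baseChange K).toAffine.Point ≃+ ((C₁ • V).baseChange K).toAffine.Point :=
    VariableChange.pointEquivBaseChange V C₁ K with he_def
  set g : ((C₁ • V).baseChange K).toAffine.Point ≃+ ((V.quadraticTwist 1).baseChange K).toAffine.Point :=
    Affine.Point.congrEquiv hC₁K with hg_def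
  obtain ⟨τ, hτf⟩ : ∃ g' : (V.quadraticTwist c).toAffine.Point →+
      ((V.quadraticTwist 1).baseChange K).toAffine.Point, ∀ P, g' P = QuadraticDescent.twistMap V hθ hc P :=
    exists_addMonoidHom_coe_eq_of_decEq _ _ (QuadraticDescent.twistMap V hθ hc)
  -- heights
  have hτ : ∀ R : (V.quadraticTwist c).toAffine.Point,
      heightPairing (τ R) (τ R) = 2 * heightPairing R R := by
    intro R
    rw [hτf]
    show heightPairing
        (Affine.Point.congrEquiv (twistUntwist_smul_baseChange V hθ hc)
          (VariableChange.pointEquiv _ (twistUntwist hθ) (QuadraticDescent.incl K (V.quadraticTwist c) R)))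
        (Affine.Point.congrEquiv (twistUntwist_smul_baseChange V hθ hc)
          (VariableChange.pointEquiv _ (twistUntwist hθ) (QuadraticDescent.incl K (V.quadraticTwist c) R))) = _
    rw [heightPairing_congrEquiv, heightPairing_pointEquiv]
    have h0 := heightPairing_baseChange (R := ℚ) (K := ℚ) (L := K) (W := V.quadraticTwist c) R R
    rw [h2] at h0
    push_cast at h0
    exact h0
  have he : ∀ X : (V.baseChange K).toAffine.Point, heightPairing (e X) (e X) = heightPairing X X := by
    intro X
    rw [he_def]
    show heightPairing
        (Affine.Point.congrEquiv (VariableChange.baseChange_smul_eq V C₁ K).symm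
          (VariableChange.pointEquiv _ (C₁.map (algebraMap ℚ K)) X))
        (Affine.Point.congrEquiv (VariableChange.baseChange_smul_eq V C₁ K).symm
          (VariableChange.pointEquiv _ (C₁.map (algebraMap ℚ K)) X)) = _
    rw [heightPairing_congrEquiv]
    have h' := heightPairing_pointEquiv (C₁.map (algebraMap ℚ K)) X X
    simp only [VariableChange.pointEquiv_apply] at h' ⊢
    exact h'
  have hg : ∀ Y, heightPairing (g Y) (g Y) = heightPairing Y Y := fun Y ↦ by
    rw [hg_def, heightPairing_congrEquiv]
  have he' : ∀ Y, heightPairing (e.symm Y) (e.symm Y) = heightPairing Y Y := fun Y ↦ by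
    conv_rhs => rw [← e.apply_symm_apply Y]
    exact (he (e.symm Y)).symm
  have hg' : ∀ Z, heightPairing (g.symm Z) (g.symm Z) = heightPairing Z Z := fun Z ↦ by
    conv_rhs => rw [← g.apply_symm_apply Z]
    exact (hg (g.symm Z)).symm
  have he₀' : ∀ P, heightPairing (e₀.symm P) (e₀.symm P) = heightPairing P P := fun P ↦ by
    conv_rhs => rw [← e₀.apply_symm_apply P]
    exact (he₀ (e₀.symm P)).symm
  -- Galois equivariance of `e` and `g`, anti-invariance of `τ`
  have heσ : ∀ Y, QuadraticDescent.conjMap V σ (e.symm Y) =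
      e.symm (Affine.Point.map (W' := C₁ • V) σ Y) := fun Y ↦ by
    rw [he_def]
    exact VariableChange.pointEquivBaseChange_symm_map V C₁ σ Y
  have hgσ : ∀ Z, Affine.Point.map (W' := C₁ • V) σ (g.symm Z) =
      g.symm (QuadraticDescent.conjMap (V.quadraticTwist 1) σ Z) := fun Z ↦ by
    apply g.injective
    rw [AddEquiv.apply_symm_apply, hg_def]
    have h := Affine.Point.congrEquiv_baseChange_map hC₁ σ (g.symm Z)
    rw [hg_def] at h
    rw [h, AddEquiv.apply_symm_apply]
  have hτσ : ∀ R, QuadraticDescent.conjMap (V.quadraticTwist 1) σ (τ R) = -τ R := fun R ↦ by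
    rw [hτf]
    exact QuadraticDescent.conjMap_twistMap V hθ hc hσθ R
  set Φ : W.toAffine.Point →+ (V.baseChange K).toAffine.Point :=
    e.symm.toAddMonoidHom.comp (g.symm.toAddMonoidHom.comp (τ.comp e₀.symm.toAddMonoidHom)) with hΦdef
  have hΦapply : ∀ P, Φ P = e.symm (g.symm (τ (e₀.symm P))) := fun P ↦ by
    simp only [hΦdef, AddMonoidHom.comp_apply, AddEquiv.coe_toAddMonoidHom]
  have hΦh : ∀ P : W.toAffine.Point, heightPairing (Φ P) (Φ P) = 2 * heightPairing P P := fun P ↦ by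
    rw [hΦapply, he', hg', hτ, he₀']
  have hΦσ : ∀ P : W.toAffine.Point, QuadraticDescent.conjMap V σ (Φ P) = -Φ P := fun P ↦ by
    rw [hΦapply, heσ, hgσ, hτσ, map_neg, map_neg]
  -- conjugation on `V(K)` is an involution
  have hcjcj : ∀ X : (V.baseChange K).toAffine.Point,
      QuadraticDescent.conjMap V σ (QuadraticDescent.conjMap V σ X) = X :=
    QuadraticDescent.conjMap_conjMap V hσσ
  -- fixed points of `σ` on `V(K)` come from `V(ℚ)`
  have hfix : ∀ X : (V.baseChange K).toAffine.Point, QuadraticDescent.conjMap V σ X = X →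
      ∃ v : V.toAffine.Point, V.pointToBaseChange K v = X := by
    rintro (_ | ⟨x, y, h⟩) hX
    · exact ⟨0, rfl⟩
    · rw [Affine.Point.map_some, Affine.Point.some.injEq] at hX
      obtain ⟨a, ha⟩ := Quadratic.exists_eq_algebraMap_of_conj_eq h2 hθ hc hX.1
      obtain ⟨b, hb⟩ := Quadratic.exists_eq_algebraMap_of_conj_eq h2 hθ hc hX.2
      subst ha hb
      exact ⟨.some a b ((Affine.map_nonsingular (W := V.toAffine) (algebraMap ℚ K).injective a b).1 h),
        rfl⟩
  -- anti-fixed points of `σ` on `V(K)` come from `W(ℚ)` through `Φ`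
  have hanti : ∀ X : (V.baseChange K).toAffine.Point, QuadraticDescent.conjMap V σ X = -X →
      ∃ w : W.toAffine.Point, Φ w = X := by
    intro X hX
    have hZ : QuadraticDescent.conjMap (V.quadraticTwist 1) σ (g (e X)) = -(g (e X)) := by
      apply g.symm.injective
      apply e.symm.injective
      rw [← hgσ, ← heσ, map_neg, map_neg, AddEquiv.symm_apply_apply, AddEquiv.symm_apply_apply, hX]
    obtain ⟨R, hR⟩ := exists_twistMap_eq_of_conjMap_eq_neg h2 hθ hc V (g (e X)) hZ
    refine ⟨e₀ R, ?_⟩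
    rw [hΦapply, AddEquiv.symm_apply_apply, hτf, hR, AddEquiv.symm_apply_apply,
      AddEquiv.symm_apply_apply]
  refine ⟨σ, Φ, hσθ, hσσ, hΦh, hΦσ, hfix, hanti, fun X ↦ ?_⟩
  -- `2X = (X + σX) + (X − σX)`
  obtain ⟨v, hv⟩ := hfix (X + QuadraticDescent.conjMap V σ X) (by rw [map_add, hcjcj, add_comm])
  obtain ⟨w, hw⟩ := hanti (X - QuadraticDescent.conjMap V σ X) (by rw [map_sub, hcjcj, neg_sub])
  refine ⟨v, w, ?_⟩
  rw [hv, hw, two_zsmul]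
  abel

end Transport

end Summit.BirchSwinnertonDyer.Rank1Residual.Additive

end
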